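/-
Copyright (c) 2026 the pub-hodgecm-mathlib formalisation cell (harness21).  Prover seat hodgecm-mathlib-K2E1-p16 (g3), Track B «K2-LIT» ENGINE E1, h413 = `stmt-HodgeConjecture-24833`,
route `HCCMUnconditional`, R90-S8 «ContSpec-n½», deals S8-R195∕R196 «R7₃ ON-AXIS REAL POLE LEDGER» (S8 dealer R90-CS-plan (g3)): the Maass–Selberg bound of the truncated χ-Eisenstein
family AT A REAL CANDIDATE POLE `z₀ ∈ (1, 2) ∖ {3∕2}` from the three-scalar diagonal relation, the reality of the cross scalar on the axis, and boundedness of the scalars.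
-/
import Summits.HodgeConjecture.HodgeConjecture.Theorems.K2E1ChiMaassSelbergDiagonalCMThree   -- ★ p862892 (this base, g2): `msRel_of_tube_letters` (any real `z₀`), `conj_chiFourTerm₂`; brings ★ `differentiableOn_conj_comp_conj`, `pairing_of_differentiableOn`
import Summits.HodgeConjecture.HodgeConjecture.Theorems.K2E1MaassSelbergPoleControl          -- ★ (K2E1-p11): `oscillatory_pair_eq_ofReal`, `cpow_neg_mul_I_eq_conj`; brings ★ `norm_ofReal_cpow_mul_I`
import Mathlib.Analysis.SpecialFunctions.Trigonometric.Bounds                                -- `Real.norm_exp_I_mul_ofReal_sub_one_le`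
import HarnessLib

/-!
# h413 ∕ R90-S8 R7₃ — `K2E1ChiEisensteinRealAxisPoleLedgerCMThree`: THE MAASS–SELBERG `L²`-BOUND OF `[Λ^T Ẽ_χ(z)]` NEAR A REAL CANDIDATE POLE `z₀ ∈ (1,2) ∖ {3∕2}`, OF LETTERS
# ([MoeglinWaldspurger1995] IV.3.12 (b): «the poles of `Ẽ` on the real segment are among the poles of the scattering scalars»)

Cell `pub/hodgecm-mathlib`, crux H413 = `stmt-HodgeConjecture-24833`; S8 dealer R90-CS-plan (g3), S8-R195 (2) ∕ S8-R196; census on the R90 bus 2026-09-05T01:22Z.  Consumer: the χ POLE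
LEDGER ★ p863972 through ★ p864057 `hbddPK_of_L2Family_letters_cm_three` (letter (MS-P′) at REAL candidate poles, `‖Fam z‖`-currency).  THEOREMS ONLY (no `def`, no `instance`, no
notation, no named-fact hypothesis, no `sorry`; default heartbeats); lane `--supports stmt-HodgeConjecture-24833 --as helper` (count-neutral).  Closes no socket.

THE MATHEMATICS ([MoeglinWaldspurger1995, IV.2.3, IV.3.12 (b)]; [Langlands1976, §7]; [Arthur1980TraceFormulaII, §4]).  Off the real axis near a real point `z₀ > 1` the `L²`-family
`F z = [Λ^T Ẽ_χ(z)]` satisfies the DIAGONAL three-scalar Maass–Selberg relation (★ `msRel_of_tube_letters`, any real `z₀`, from the tube formula on both quarter-planes):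
  `‖F z‖² ≤ ‖Cμ·CK·( T^{2x}∕(2x)·a + T^{2iy}∕(2iy)·conj(w z) − T^{−2iy}∕(2iy)·w z − T^{−2x}∕(2x)·B z z )‖`,  `x = Re z − 1`, `y = Im z ≠ 0`.
The outer terms are bounded near `z₀` as soon as the scalars `w`, `B(·,·)` are (the SCALAR HALF of the ledger: `qc` holomorphic at `z₀`).  The OSCILLATORY PAIR equals `Im(T^{2iy}·conj(w z))∕y` (★
`oscillatory_pair_eq_ofReal`), and `|Im(T^{2iy}W)| ≤ ‖T^{2iy} − 1‖·‖W‖ + |Im W| ≤ 2|y| log T·‖W‖ + |Im W|` (§1): it is bounded iff **`|Im w(z)| = O(|Im z|)`** — the ONE analytic input on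
the axis, which holds exactly when `w` is REAL ON THE REAL AXIS near `z₀` and holomorphic there (§2, Schwarz reflection `conj(w(z̄)) = w(z)` + the mean-value inequality:
`|Im w(z)| = ‖w z − w z̄‖∕2 ≤ L·|Im z|`).  For a NON-self-associate block `w ≡ 0` (★ `bracket_character_eq_zero`) and the input is void; for a SELF-associate block it is the adjoint functional
equation of the intertwining operator read through the Gram constants (the letter `hreal`).  At the real points `z ≠ z₀` themselves the bound passes to the limit along `z + it`, `t ↓ 0`, by
continuity of `F` (★ (E6): `F` is holomorphic off the closed-discrete candidate set).
* §1 **`norm_oscillatoryPair_le`**, **`norm_chiFourTerm_diag_le`** — the algebra (no positivity, no Cauchy–Schwarz).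
* §2 **`exists_abs_im_le_of_real_on_axis`** — `w` holomorphic on a ball around a real point and real on its real diameter ⇒ `∃ Cw, ∀ᶠ z in 𝓝 ↑x₀, |Im (w z)| ≤ Cw·|Im z|`.
* §3 **`norm_le_of_continuousAt_of_eventually`** (the limit along `z + it`), and THE HEAD **`msBound_realPoint_of_letters`**: ★ `msRel_of_tube_letters`' frame VERBATIM (`z₀ : ℝ`, domains
  `D₁ ⊆ D⁺`, `D₂ ⊆ D⁻` with boxes, `hD₁ev hD₂ev`, tube relation on both, `w B` holomorphic on both, `F` holomorphic on both) + `1 ≤ T`, `0 ≤ Cμ`, `0 ≤ CK` + the near-`z₀` scalar letters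
  `hwbd hIm hBbd` + continuity of `F` at the real points near `z₀` ⊢ **`∃ C, ∀ᶠ z in 𝓝[≠] ↑z₀, ‖F z‖ ≤ C`**.
WHAT STAYS A LETTER (honest, named): the scalar half near `z₀` (`w`, `B` bounded near `z₀` — ★ (L2) `differentiableOn_wc∕Bc` from `qc` analytic at `z₀`, ★ F4∕F5 «the only pole of `qc` on
`{1 < Re}` is `3∕2`»), `hIm` (⇐ §2 from `hreal` + holomorphy of `w` across the axis — `hreal` is the self-associate adjoint functional equation [MoeglinWaldspurger1995, IV.1.10], void off the
self-associate blocks), the frame letters of ★ `msRel_of_tube_letters` (tube relation ★ `chiTube_threeScalars_uniform_free`, boxes, (E6) holomorphy), continuity of `F` at real non-poles.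
HONEST LABEL: HC_CM is proved only modulo the 7 printed citations (2 remaining named inputs: hLiu418 = `stmt-HodgeConjecture-24832`, h413 = `stmt-HodgeConjecture-24833`) until rung 0
closes; this file asserts no named fact and closes no socket; its head is CONDITIONAL on the named letters; count-neutral.

## References
* [MoeglinWaldspurger1995] C. Mœglin, J.-L. Waldspurger, *Spectral Decomposition and Eisenstein Series* (1995), IV.1.10, IV.2.3, IV.3.12 (b).
* [Langlands1976] R. P. Langlands, *On the Functional Equations Satisfied by Eisenstein Series*, LNM 544 (1976), §7.
* [Arthur1980TraceFormulaII] J. Arthur, *A trace formula for reductive groups II*, Compositio Math. 40 (1980), §4.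
-/

set_option autoImplicit false
-- the mandated namespace repeats the single-problem summit's segment (`HodgeConjecture.HodgeConjecture`)
set_option linter.dupNamespace false

noncomputable section

open MeasureTheory Set Filter Topology Metric
open scoped NNReal ComplexConjugate InnerProductSpace
open Summit.HodgeConjecture.HodgeConjecture.Cruxes.H413.K2E1MaassSelbergContinuedCMTwo (differentiableOn_conj_comp_conj)
open Summit.HodgeConjecture.HodgeConjecture.Cruxes.H413.K2E1MaassSelbergPoleControl (oscillatory_pair_eq_ofReal cpow_neg_mul_I_eq_conj)
open Summit.HodgeConjecture.HodgeConjecture.Cruxes.H413.K2E1MaassSelbergPoleInequality (norm_ofReal_cpow_mul_I)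
open Summit.HodgeConjecture.HodgeConjecture.Cruxes.H413.K2E1ChiMaassSelbergDiagonalCMThree (msRel_of_tube_letters)

namespace Summit.HodgeConjecture.HodgeConjecture.Cruxes.H413.K2E1ChiEisensteinRealAxisPoleLedgerCMThree

/-! ## §1 The algebra of the diagonal four-term near the real axis -/

section Algebra

/-- **`‖T^{2iy} − 1‖ ≤ 2|y|·log T`** for `T ≥ 1` (`T^{2iy} = exp(i·2y log T)`, Mathlib `Real.norm_exp_I_mul_ofReal_sub_one_le`). [cite: MoeglinWaldspurger1995, IV.3.12] -/
theorem norm_cpow_mul_I_sub_one_le {T : ℝ} (hT : 1 ≤ T) (y : ℝ) :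
    ‖(T : ℂ) ^ (((2 * y : ℝ) : ℂ) * Complex.I) - 1‖ ≤ 2 * |y| * Real.log T := by
  have hT0 : 0 < T := lt_of_lt_of_le one_pos hT
  have hne : (T : ℂ) ≠ 0 := by exact_mod_cast hT0.ne'
  have hexp : (T : ℂ) ^ (((2 * y : ℝ) : ℂ) * Complex.I) = Complex.exp (Complex.I * ((2 * y * Real.log T : ℝ) : ℂ)) := by
    rw [Complex.cpow_def_of_ne_zero hne, (Complex.ofReal_log hT0.le).symm]
    congr 1
    push_cast
    ring
  rw [hexp]
  refine (Real.norm_exp_I_mul_ofReal_sub_one_le).trans ?_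
  rw [Real.norm_eq_abs, abs_mul, abs_mul, abs_of_nonneg (Real.log_nonneg hT), abs_two]

/-- **THE OSCILLATORY PAIR IS `O(1)` WHEN `Im W = O(|y|)`**: for `T ≥ 1`, `y ≠ 0` and `|Im W| ≤ Cw·|y|`:
`‖T^{2iy}∕(2iy)·W − T^{−2iy}∕(2iy)·conj W‖ ≤ 2 log T·‖W‖ + Cw` — the pair is `Im(T^{2iy}W)∕y` (★ `oscillatory_pair_eq_ofReal`) and `|Im(T^{2iy}W)| ≤ ‖T^{2iy} − 1‖‖W‖ + |Im W|`.
[cite: MoeglinWaldspurger1995, IV.3.12 (b)] -/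
theorem norm_oscillatoryPair_le {T : ℝ} (hT : 1 ≤ T) (W : ℂ) {y : ℝ} (hy : y ≠ 0) {Cw : ℝ} (hW : |W.im| ≤ Cw * |y|) :
    ‖(T : ℂ) ^ (((2 * y : ℝ) : ℂ) * Complex.I) / (((2 * y : ℝ) : ℂ) * Complex.I) * W -
        (T : ℂ) ^ (-(((2 * y : ℝ) : ℂ) * Complex.I)) / (((2 * y : ℝ) : ℂ) * Complex.I) * conj W‖ ≤ 2 * Real.log T * ‖W‖ + Cw := by
  have hT0 : 0 < T := lt_of_lt_of_le one_pos hT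
  rw [cpow_neg_mul_I_eq_conj hT0, oscillatory_pair_eq_ofReal _ W hy, Complex.norm_real, Real.norm_eq_abs, abs_div]
  set u : ℂ := (T : ℂ) ^ (((2 * y : ℝ) : ℂ) * Complex.I) with hu
  have hsplit : (u * W).im = ((u - 1) * W).im + W.im := by
    rw [sub_mul, one_mul, Complex.sub_im, sub_add_cancel]
  have h1 : |((u - 1) * W).im| ≤ 2 * |y| * Real.log T * ‖W‖ :=
    (Complex.abs_im_le_norm _).trans (by rw [norm_mul]; exact mul_le_mul_of_nonneg_right (norm_cpow_mul_I_sub_one_le hT y) (norm_nonneg _))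
  have hy0 : 0 < |y| := abs_pos.2 hy
  rw [div_le_iff₀ hy0, hsplit]
  calc |((u - 1) * W).im + W.im| ≤ |((u - 1) * W).im| + |W.im| := abs_add_le _ _
    _ ≤ 2 * |y| * Real.log T * ‖W‖ + Cw * |y| := add_le_add h1 hW
    _ = (2 * Real.log T * ‖W‖ + Cw) * |y| := by ring

/-- **THE DIAGONAL FOUR-TERM IS BOUNDED NEAR A REAL POINT, GIVEN `Im w = O(|Im z|)`**: for `T ≥ 1`, `0 ≤ Cμ`, `0 ≤ CK`, `Re z − 1 ∈ [x₁, x₂]` (`x₁ > 0`), `Im z ≠ 0` and `|Im w| ≤ Cw·|Im z|`: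
`‖Cμ·CK·(T^{z+z̄−2}∕(z+z̄−2)·a + T^{z−z̄}∕(z−z̄)·conj w − T^{−(z−z̄)}∕(z−z̄)·w − T^{−(z+z̄−2)}∕(z+z̄−2)·B)‖ ≤ Cμ·CK·(T^{2x₂}∕(2x₁)·|a| + (2 log T·‖w‖ + Cw) + ‖B‖∕(2x₁))`.
(`z+z̄−2 = 2x` real, `z−z̄ = 2iy`; `T^{2x} ≤ T^{2x₂}`, `T^{−2x} ≤ 1`; the oscillatory pair by `norm_oscillatoryPair_le` with `W := conj w`.) [cite: MoeglinWaldspurger1995, IV.2.3, IV.3.12 (b)] -/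
theorem norm_chiFourTerm_diag_le {Cμ CK a T : ℝ} (hCμ : 0 ≤ Cμ) (hCK : 0 ≤ CK) (hT : 1 ≤ T) {x₁ x₂ : ℝ} (hx₁ : 0 < x₁) {z : ℂ} (hx : z.re - 1 ∈ Icc x₁ x₂) (hy : z.im ≠ 0)
    (w B : ℂ) {Cw : ℝ} (hIm : |w.im| ≤ Cw * |z.im|) :
    ‖((Cμ : ℝ) : ℂ) * (((CK : ℝ) : ℂ) *
        ((((T : ℝ) : ℂ) ^ (z + conj z - 2) / (z + conj z - 2)) * ((a : ℝ) : ℂ)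
          + (((T : ℝ) : ℂ) ^ (z - conj z) / (z - conj z)) * conj w
          - (((T : ℝ) : ℂ) ^ (-(z - conj z)) / (z - conj z)) * w
          - (((T : ℝ) : ℂ) ^ (-(z + conj z - 2)) / (z + conj z - 2)) * B))‖
      ≤ Cμ * (CK * (T ^ (2 * x₂) / (2 * x₁) * |a| + (2 * Real.log T * ‖w‖ + Cw) + ‖B‖ / (2 * x₁))) := by
  have hT0 : 0 < T := lt_of_lt_of_le one_pos hT
  set x : ℝ := z.re - 1 with hxdef
  have hx0 : 0 < x := hx₁.trans_le hx.1
  -- the two exponents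
  have hs₁ : z + conj z - 2 = ((2 * x : ℝ) : ℂ) := by
    apply Complex.ext
    · simp only [hxdef, Complex.sub_re, Complex.add_re, Complex.conj_re, Complex.ofReal_re]
      norm_num
      ring
    · simp
  have hs₂ : z - conj z = ((2 * z.im : ℝ) : ℂ) * Complex.I := Complex.sub_conj z
  rw [hs₁, hs₂]
  -- the outer terms
  have h2x : (0 : ℝ) < 2 * x := by positivity
  have h2x₁ : (0 : ℝ) < 2 * x₁ := by positivity
  have hA : ‖((T : ℝ) : ℂ) ^ ((2 * x : ℝ) : ℂ) / ((2 * x : ℝ) : ℂ) * ((a : ℝ) : ℂ)‖ ≤ T ^ (2 * x₂) / (2 * x₁) * |a| := by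
    rw [norm_mul, norm_div, Complex.norm_cpow_eq_rpow_re_of_pos hT0, Complex.ofReal_re, Complex.norm_real, Complex.norm_real, Real.norm_eq_abs, Real.norm_eq_abs,
      abs_of_pos h2x]
    refine mul_le_mul_of_nonneg_right ?_ (abs_nonneg a)
    exact div_le_div₀ (Real.rpow_nonneg hT0.le _) (Real.rpow_le_rpow_of_exponent_le hT (by linarith [hx.2])) h2x₁ (by linarith [hx.1])
  have hD : ‖((T : ℝ) : ℂ) ^ (-((2 * x : ℝ) : ℂ)) / ((2 * x : ℝ) : ℂ) * B‖ ≤ ‖B‖ / (2 * x₁) := by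
    rw [norm_mul, norm_div, ← Complex.ofReal_neg, Complex.norm_cpow_eq_rpow_re_of_pos hT0, Complex.ofReal_re, Complex.norm_real, Real.norm_eq_abs, abs_of_pos h2x]
    have hle1 : T ^ (-(2 * x)) ≤ 1 := Real.rpow_le_one_of_one_le_of_nonpos hT (by linarith)
    calc T ^ (-(2 * x)) / (2 * x) * ‖B‖ ≤ 1 / (2 * x₁) * ‖B‖ :=
          mul_le_mul_of_nonneg_right (div_le_div₀ zero_le_one hle1 h2x₁ (by linarith [hx.1])) (norm_nonneg B)
      _ = ‖B‖ / (2 * x₁) := by ring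
  -- the oscillatory pair with `W := conj w`
  have hW : |(conj w).im| ≤ Cw * |z.im| := by rw [Complex.conj_im, abs_neg]; exact hIm
  have hO := norm_oscillatoryPair_le hT (conj w) hy hW
  rw [Complex.conj_conj, RCLike.norm_conj] at hO
  -- assemble
  rw [norm_mul, norm_mul, Complex.norm_real, Complex.norm_real, Real.norm_eq_abs, Real.norm_eq_abs, abs_of_nonneg hCμ, abs_of_nonneg hCK]
  refine mul_le_mul_of_nonneg_left (mul_le_mul_of_nonneg_left ?_ hCK) hCμ
  have hsplit : ∀ A P Q D : ℂ, ‖A + P - Q - D‖ ≤ ‖A‖ + ‖P - Q‖ + ‖D‖ := fun A P Q D => by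
    calc ‖A + P - Q - D‖ = ‖A + (P - Q) - D‖ := by ring_nf
      _ ≤ ‖A + (P - Q)‖ + ‖D‖ := norm_sub_le _ _
      _ ≤ ‖A‖ + ‖P - Q‖ + ‖D‖ := by gcongr; exact norm_add_le _ _
  exact (hsplit _ _ _ _).trans (add_le_add (add_le_add hA hO) hD)

end Algebra

/-! ## §2 Reality on the axis ⟹ `|Im w(z)| = O(|Im z|)` -/

section Reflection

/-- **SCHWARZ REFLECTION + MEAN VALUE**: if `w` is holomorphic on the ball `B(x₀, r)` around a REAL point `x₀` and REAL at the real points of the ball, then `conj (w z̄) = w z` on the ball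
(identity theorem: both sides are analytic and agree on the real diameter, which accumulates at `x₀`), hence `|Im w(z)| = ‖w z − w z̄‖∕2 ≤ L·|Im z|` on `B(x₀, r∕2)` with `L` a bound of `w′`
on the closed half-ball: **`∃ Cw, ∀ᶠ z in 𝓝 ↑x₀, |Im (w z)| ≤ Cw·|Im z|`**. [cite: MoeglinWaldspurger1995, IV.3.12 (b)] [cite: Langlands1976, §7] -/
theorem exists_abs_im_le_of_real_on_axis {w : ℂ → ℂ} {x₀ r : ℝ} (hr : 0 < r) (hw : DifferentiableOn ℂ w (ball (x₀ : ℂ) r))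
    (hreal : ∀ x : ℝ, (x : ℂ) ∈ ball (x₀ : ℂ) r → (w x).im = 0) :
    ∃ Cw : ℝ, ∀ᶠ z in 𝓝 (x₀ : ℂ), |(w z).im| ≤ Cw * |z.im| := by
  -- the ball is symmetric under conjugation
  have hsymm : ∀ {z : ℂ} {ρ : ℝ}, z ∈ ball (x₀ : ℂ) ρ → conj z ∈ ball (x₀ : ℂ) ρ := fun {z ρ} hz => by
    rw [mem_ball, Complex.dist_eq] at hz ⊢
    rwa [← Complex.conj_ofReal, ← map_sub, RCLike.norm_conj]
  have hset : {u : ℂ | conj u ∈ ball (x₀ : ℂ) r} = ball (x₀ : ℂ) r :=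
    Set.ext fun u => ⟨fun hu => by simpa only [Complex.conj_conj] using hsymm hu, fun hu => hsymm hu⟩
  -- the reflected function and the identity `conj (w (conj z)) = w z` on the ball
  have hg : DifferentiableOn ℂ (fun u : ℂ => conj (w (conj u))) (ball (x₀ : ℂ) r) := by
    have h := differentiableOn_conj_comp_conj isOpen_ball hw
    rwa [hset] at h
  have hwa : AnalyticOnNhd ℂ w (ball (x₀ : ℂ) r) := hw.analyticOnNhd isOpen_ball
  have hga : AnalyticOnNhd ℂ (fun u : ℂ => conj (w (conj u))) (ball (x₀ : ℂ) r) := hg.analyticOnNhd isOpen_ball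
  have hx₀ : (x₀ : ℂ) ∈ ball (x₀ : ℂ) r := mem_ball_self hr
  have hfreq : ∃ᶠ z in 𝓝[≠] (x₀ : ℂ), w z = conj (w (conj z)) := by
    refine Filter.frequently_iff.2 fun {U} hU => ?_
    obtain ⟨ε, hε, hεU⟩ := Metric.mem_nhdsWithin_iff.1 hU
    have hmemb : ((x₀ + min ε r / 2 : ℝ) : ℂ) ∈ ball (x₀ : ℂ) (min ε r) := by
      rw [mem_ball, Complex.dist_eq, ← Complex.ofReal_sub, Complex.norm_real, Real.norm_eq_abs, add_sub_cancel_left, abs_of_pos (by positivity)]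
      exact half_lt_self (lt_min hε hr)
    refine ⟨((x₀ + min ε r / 2 : ℝ) : ℂ), hεU ⟨ball_subset_ball (min_le_left _ _) hmemb, ?_⟩, ?_⟩
    · show ((x₀ + min ε r / 2 : ℝ) : ℂ) ≠ (x₀ : ℂ)
      rw [Ne, Complex.ofReal_inj]
      have : 0 < min ε r / 2 := by positivity
      linarith
    · have hrealpt := hreal (x₀ + min ε r / 2) (ball_subset_ball (min_le_right _ _) hmemb)
      rw [Complex.conj_ofReal, eq_comm]
      exact Complex.conj_eq_iff_im.2 hrealpt
  have heq : EqOn w (fun u : ℂ => conj (w (conj u))) (ball (x₀ : ℂ) r) :=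
    hwa.eqOn_of_preconnected_of_frequently_eq hga (convex_ball _ _).isPreconnected hx₀ hfreq
  -- a bound for `w′` on the closed half-ball
  have hcl : closedBall (x₀ : ℂ) (r / 2) ⊆ ball (x₀ : ℂ) r := closedBall_subset_ball (by linarith)
  obtain ⟨L, hL⟩ := (isCompact_closedBall (x₀ : ℂ) (r / 2)).exists_bound_of_continuousOn ((hwa.deriv.continuousOn).mono hcl)
  refine ⟨max L 0, ?_⟩
  filter_upwards [Metric.ball_mem_nhds (x₀ : ℂ) (show (0 : ℝ) < r / 2 by linarith)] with z hz
  have hzc : z ∈ closedBall (x₀ : ℂ) (r / 2) := ball_subset_closedBall hz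
  have hzc' : conj z ∈ closedBall (x₀ : ℂ) (r / 2) := ball_subset_closedBall (hsymm hz)
  -- mean value on the convex closed half-ball
  have hmv : ‖w (conj z) - w z‖ ≤ max L 0 * ‖conj z - z‖ :=
    (convex_closedBall (x₀ : ℂ) (r / 2)).norm_image_sub_le_of_norm_deriv_le (fun u hu => hwa.differentiableOn.differentiableAt (isOpen_ball.mem_nhds (hcl hu)))
      (fun u hu => (hL u hu).trans (le_max_left _ _)) hzc hzc'
  -- `w (conj z) = conj (w z)` and the norms of `conj v − v`
  have hwcz : w (conj z) = conj (w z) := by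
    have h := heq (hsymm (ball_subset_ball (by linarith) hz) : conj z ∈ ball (x₀ : ℂ) r)
    simpa only [Complex.conj_conj] using h
  have hnorm : ∀ v : ℂ, ‖conj v - v‖ = 2 * |v.im| := fun v => by
    rw [← neg_sub, norm_neg, Complex.sub_conj, norm_mul, Complex.norm_I, mul_one, Complex.norm_real, Real.norm_eq_abs, abs_mul, abs_two]
  rw [hwcz, hnorm, hnorm] at hmv
  nlinarith [hmv, abs_nonneg (w z).im, abs_nonneg z.im, le_max_right L 0]

end Reflection

/-! ## §3 The `L²`-bound near a real candidate pole, of letters -/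

section Head

variable {H : Type*} [NormedAddCommGroup H] [InnerProductSpace ℂ H]

omit [InnerProductSpace ℂ H] in
/-- **PASSING TO THE AXIS**: if `F` is continuous at `z` and `‖F (z + t·i)‖ ≤ C` for all small `t > 0`, then `‖F z‖ ≤ C` (limit along the vertical segment). [folklore] -/
theorem norm_le_of_continuousAt_of_eventually {F : ℂ → H} {z : ℂ} {C : ℝ} (hc : ContinuousAt F z)
    (h : ∀ᶠ t : ℝ in 𝓝[>] 0, ‖F (z + (t : ℂ) * Complex.I)‖ ≤ C) : ‖F z‖ ≤ C := by
  have hpath : Tendsto (fun t : ℝ => z + (t : ℂ) * Complex.I) (𝓝[>] 0) (𝓝 z) := by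
    have h0 : Tendsto (fun t : ℝ => z + (t : ℂ) * Complex.I) (𝓝 0) (𝓝 (z + ((0 : ℝ) : ℂ) * Complex.I)) :=
      tendsto_const_nhds.add ((Complex.continuous_ofReal.tendsto 0).mul tendsto_const_nhds)
    rw [Complex.ofReal_zero, zero_mul, add_zero] at h0
    exact h0.mono_left nhdsWithin_le_nhds
  have hlim : Tendsto (fun t : ℝ => ‖F (z + (t : ℂ) * Complex.I)‖) (𝓝[>] 0) (𝓝 ‖F z‖) := (hc.tendsto.comp hpath).norm
  exact le_of_tendsto hlim h

/-- **R7₃ HEAD — THE MAASS–SELBERG BOUND OF THE TRUNCATED χ-FAMILY NEAR A REAL CANDIDATE POLE, OF LETTERS** ([MoeglinWaldspurger1995] IV.3.12 (b)).  Frame = ★ `msRel_of_tube_letters`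
VERBATIM: a real `z₀` (consumer: `z₀ ∈ (1,2) ∖ {3∕2}`, `1 < z₀`), an upper domain `D₁ ⊆ D⁺` and a lower domain `D₂ ⊆ D⁻` (open, preconnected, sub-tube boxes) covering the punctured
neighbourhood of `z₀` off the axis (`hD₁ev hD₂ev`), the family `F` holomorphic on both, the χ Maass–Selberg tube formula on both (`hMStube₁ hMStube₂`), the scalars `w`, `B` holomorphic on both;
PLUS `1 ≤ T`, `0 ≤ Cμ`, `0 ≤ CK`, and the near-`z₀` letters: `hwbd` (`w` bounded), `hIm` (`|Im w z| ≤ Cw·|Im z|` — §2 from reality on the axis), `hBbd` (`B z z` bounded), `hFc` (`F` continuous at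
the real points `z ≠ z₀` near `z₀`).  THEN **`∃ C, ∀ᶠ z in 𝓝[≠] ↑z₀, ‖F z‖ ≤ C`** — the (MS-P′) letter at a REAL candidate pole.
[cite: MoeglinWaldspurger1995, IV.2.3, IV.3.12 (b)] [cite: Langlands1976, §7] [cite: Arthur1980TraceFormulaII, §4] -/
theorem msBound_realPoint_of_letters (z₀ : ℝ) (hz₀ : 1 < z₀)
    {D₁ : Set ℂ} (hD₁ : IsOpen D₁) (hD₁c : IsPreconnected D₁) (hD₁sub : D₁ ⊆ {z : ℂ | 1 < z.re ∧ 0 < z.im})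
    {O₁ O₂' : Set ℂ} (hO₁ : IsOpen O₁) (hO₁ne : O₁.Nonempty) (hO₁D : O₁ ⊆ D₁) (hO₂' : IsOpen O₂') (hO₂'ne : O₂'.Nonempty) (hO₂'D : O₂' ⊆ D₁)
    (hsep : ∀ z ∈ O₁, ∀ z' ∈ O₂', 2 < z'.re ∧ z'.re < z.re)
    {D₂ : Set ℂ} (hD₂ : IsOpen D₂) (hD₂c : IsPreconnected D₂) (hD₂sub : D₂ ⊆ {z : ℂ | 1 < z.re ∧ z.im < 0})
    {Q₁ Q₂' : Set ℂ} (hQ₁ : IsOpen Q₁) (hQ₁ne : Q₁.Nonempty) (hQ₁D : Q₁ ⊆ D₂) (hQ₂' : IsOpen Q₂') (hQ₂'ne : Q₂'.Nonempty) (hQ₂'D : Q₂' ⊆ D₂)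
    (hsep₂ : ∀ z ∈ Q₁, ∀ z' ∈ Q₂', 2 < z'.re ∧ z'.re < z.re)
    (hD₁ev : ∀ᶠ z : ℂ in 𝓝[≠] (z₀ : ℂ), 0 < z.im → z ∈ D₁) (hD₂ev : ∀ᶠ z : ℂ in 𝓝[≠] (z₀ : ℂ), z.im < 0 → z ∈ D₂)
    {Cμ CK : ℝ} (hCμ : 0 ≤ Cμ) (hCK : 0 ≤ CK) (a : ℝ) {T : ℝ} (hT : 1 ≤ T)
    {w : ℂ → ℂ} (hw₁ : DifferentiableOn ℂ w D₁) (hw₂ : DifferentiableOn ℂ w D₂)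
    {B : ℂ → ℂ → ℂ} (hB₁ : ∀ z' ∈ D₁, DifferentiableOn ℂ (fun z : ℂ => B z z') D₁) (hB₂ : ∀ z ∈ D₁, DifferentiableOn ℂ (fun u : ℂ => B z (conj u)) {u : ℂ | conj u ∈ D₁})
    (hB₁' : ∀ z' ∈ D₂, DifferentiableOn ℂ (fun z : ℂ => B z z') D₂) (hB₂' : ∀ z ∈ D₂, DifferentiableOn ℂ (fun u : ℂ => B z (conj u)) {u : ℂ | conj u ∈ D₂})
    (F : ℂ → H) (hFd₁ : DifferentiableOn ℂ F D₁) (hFd₂ : DifferentiableOn ℂ F D₂)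
    (hMStube₁ : ∀ z ∈ D₁, ∀ z' ∈ D₁, 2 < z'.re → z'.re < z.re →
      ⟪F z', F z⟫_ℂ = ((Cμ : ℝ) : ℂ) * (((CK : ℝ) : ℂ) *
        ((((T : ℝ) : ℂ) ^ (z + conj z' - 2) / (z + conj z' - 2)) * ((a : ℝ) : ℂ)
          + (((T : ℝ) : ℂ) ^ (z - conj z') / (z - conj z')) * conj (w z')
          - (((T : ℝ) : ℂ) ^ (-(z - conj z')) / (z - conj z')) * w z
          - (((T : ℝ) : ℂ) ^ (-(z + conj z' - 2)) / (z + conj z' - 2)) * B z z')))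
    (hMStube₂ : ∀ z ∈ D₂, ∀ z' ∈ D₂, 2 < z'.re → z'.re < z.re →
      ⟪F z', F z⟫_ℂ = ((Cμ : ℝ) : ℂ) * (((CK : ℝ) : ℂ) *
        ((((T : ℝ) : ℂ) ^ (z + conj z' - 2) / (z + conj z' - 2)) * ((a : ℝ) : ℂ)
          + (((T : ℝ) : ℂ) ^ (z - conj z') / (z - conj z')) * conj (w z')
          - (((T : ℝ) : ℂ) ^ (-(z - conj z')) / (z - conj z')) * w z
          - (((T : ℝ) : ℂ) ^ (-(z + conj z' - 2)) / (z + conj z' - 2)) * B z z')))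
    (hwbd : ∃ Mw : ℝ, ∀ᶠ z : ℂ in 𝓝 (z₀ : ℂ), ‖w z‖ ≤ Mw) (hIm : ∃ Cw : ℝ, ∀ᶠ z : ℂ in 𝓝 (z₀ : ℂ), |(w z).im| ≤ Cw * |z.im|)
    (hBbd : ∃ MB : ℝ, ∀ᶠ z : ℂ in 𝓝 (z₀ : ℂ), ‖B z z‖ ≤ MB)
    (hFc : ∀ᶠ z : ℂ in 𝓝[≠] (z₀ : ℂ), z.im = 0 → ContinuousAt F z) :
    ∃ C : ℝ, ∀ᶠ z : ℂ in 𝓝[≠] (z₀ : ℂ), ‖F z‖ ≤ C := by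
  obtain ⟨Mw, hMw⟩ := hwbd
  obtain ⟨Cw, hCw⟩ := hIm
  obtain ⟨MB, hMB⟩ := hBbd
  -- the relation off the axis (★), and the `x`-window `Re z − 1 ∈ [x₁, x₂]` near `z₀`
  have hrel := msRel_of_tube_letters z₀ hD₁ hD₁c hD₁sub hO₁ hO₁ne hO₁D hO₂' hO₂'ne hO₂'D hsep hD₂ hD₂c hD₂sub hQ₁ hQ₁ne hQ₁D hQ₂' hQ₂'ne hQ₂'D hsep₂ hD₁ev hD₂ev Cμ CK a
    (lt_of_lt_of_le one_pos hT) hw₁ hw₂ hB₁ hB₂ hB₁' hB₂' F hFd₁ hFd₂ hMStube₁ hMStube₂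
  set x₁ : ℝ := (z₀ - 1) / 2 with hx₁
  set x₂ : ℝ := z₀ with hx₂
  have hx₁0 : 0 < x₁ := by rw [hx₁]; linarith
  have hwin : ∀ᶠ z : ℂ in 𝓝 (z₀ : ℂ), z.re - 1 ∈ Icc x₁ x₂ := by
    have hre : ContinuousAt (fun z : ℂ => z.re) (z₀ : ℂ) := Complex.continuous_re.continuousAt
    have h1 : ∀ᶠ z : ℂ in 𝓝 (z₀ : ℂ), x₁ + 1 < z.re := hre.eventually (Ioi_mem_nhds (by simp only [Complex.ofReal_re]; rw [hx₁]; linarith))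
    have h2 : ∀ᶠ z : ℂ in 𝓝 (z₀ : ℂ), z.re < x₂ + 1 := hre.eventually (Iio_mem_nhds (by simp only [Complex.ofReal_re]; rw [hx₂]; linarith))
    filter_upwards [h1, h2] with z hz1 hz2
    exact ⟨by linarith, by linarith⟩
  -- the explicit constant off the axis
  set C₀ : ℝ := Cμ * (CK * (T ^ (2 * x₂) / (2 * x₁) * |a| + (2 * Real.log T * Mw + |Cw|) + MB / (2 * x₁))) with hC₀
  have hoff : ∀ᶠ z : ℂ in 𝓝[≠] (z₀ : ℂ), z.im ≠ 0 → ‖F z‖ ≤ Real.sqrt C₀ := by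
    filter_upwards [hrel, mem_nhdsWithin_of_mem_nhds hwin, mem_nhdsWithin_of_mem_nhds hMw, mem_nhdsWithin_of_mem_nhds hCw, mem_nhdsWithin_of_mem_nhds hMB]
      with z hz hzx hzw hzI hzB hzim
    have hIm' : |(w z).im| ≤ |Cw| * |z.im| := hzI.trans (mul_le_mul_of_nonneg_right (le_abs_self Cw) (abs_nonneg _))
    have hfour := norm_chiFourTerm_diag_le (a := a) hCμ hCK hT hx₁0 hzx hzim (w z) (B z z) hIm'
    have hle : ‖F z‖ ^ 2 ≤ C₀ := by
      refine ((hz hzim).trans hfour).trans ?_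
      rw [hC₀]
      have hlog : 0 ≤ 2 * Real.log T := by positivity [Real.log_nonneg hT]
      gcongr
    exact Real.le_sqrt_of_sq_le hle
  -- an explicit punctured ball on which both the off-axis bound and the continuity at real points hold
  obtain ⟨ε, hε, hεsub⟩ := Metric.mem_nhdsWithin_iff.1 (hoff.and hFc)
  refine ⟨Real.sqrt C₀, Metric.mem_nhdsWithin_iff.2 ⟨ε, hε, fun z hz => ?_⟩⟩
  obtain ⟨hzoff, hzc⟩ := hεsub hz
  by_cases hzim : z.im = 0
  · -- a real point: pass to the limit along `z + t·i`, `t ↓ 0`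
    refine norm_le_of_continuousAt_of_eventually (hzc hzim) ?_
    -- for small `t > 0`, `z + t·i` lies in the punctured ball and off the axis
    have hzball : z ∈ ball (z₀ : ℂ) ε := hz.1
    obtain ⟨δ, hδ, hδsub⟩ := Metric.mem_nhds_iff.1 (isOpen_ball.mem_nhds hzball)
    have hsmall : ∀ᶠ t : ℝ in 𝓝[>] 0, t < δ := nhdsWithin_le_nhds (Iio_mem_nhds hδ)
    filter_upwards [hsmall, self_mem_nhdsWithin] with t htδ htpos
    have htpos' : (0 : ℝ) < t := htpos
    have hmem : z + (t : ℂ) * Complex.I ∈ ball (z₀ : ℂ) ε := by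
      refine hδsub ?_
      rw [mem_ball, dist_eq_norm, add_sub_cancel_left, norm_mul, Complex.norm_real, Complex.norm_I, mul_one, Real.norm_eq_abs, abs_of_pos htpos']
      exact htδ
    have him : (z + (t : ℂ) * Complex.I).im = t := by simp [hzim]
    have hne : z + (t : ℂ) * Complex.I ≠ (z₀ : ℂ) := fun h => by
      have := congrArg Complex.im h
      rw [him, Complex.ofReal_im] at this
      exact htpos'.ne' this
    exact (hεsub ⟨hmem, hne⟩).1 (by rw [him]; exact htpos'.ne')
  · exact hzoff hzim

end Head

end Summit.HodgeConjecture.HodgeConjecture.Cruxes.H413.K2E1ChiEisensteinRealAxisPoleLedgerCMThree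

end
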